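import Summits.BirchSwinnertonDyer.BirchSwinnertonDyer.Theses.ThetaPartnerAtTwo
import HarnessLib

/-!
# Route `ThetaPartnerAtTwo` (TP2) — glue of the KZ-window split of K2R0P♭ `SignedMainConjectureCMTwoRankZeroOfPubOfFlat`
# (stmt-BirchSwinnertonDyer-26471, gen 1, route rev 44): item stmt-BirchSwinnertonDyer-28308 `SignedMainConjectureCMTwoRankZeroOfPubOfFlatGlue`

HONEST FRAMING (cell `pub/bsd-wall`, W-ALL row 1 TP2 K2 column; width seat `bsd-tp2-w5` g0 under director-bsd (195)/(197)).
Pure glue, the `fun h1 h2 => h2 h1` term certified by the pen (bsd-wall-p2 g17, cert KZctxTP2s.lean): the children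
C1 `KatoZetaErlKSideCMAtTwoSupply` (stmt-…-28306, HOLD = published inputs Kato 2004 §12/§15, Kobayashi 2003 (8.23), JLK 2011 Thm. 5.7) and
C2 `SignedMainConjectureCMTwoRankZeroOfPubOfFlatOfKZ` (stmt-…-28307, := C1 → K2R0P♭) give the parent K2R0P♭. Nothing is proved about any
curve here; C1 stays a HOLD; BSD is NOT proved by any of this.
-/

set_option autoImplicit false
set_option linter.dupNamespace false

namespace Summit.BirchSwinnertonDyer.BirchSwinnertonDyer.Theorems

/-- **Glue 28308 BY NAME**: `KatoZetaErlKSideCMAtTwoSupply → SignedMainConjectureCMTwoRankZeroOfPubOfFlatOfKZ →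
SignedMainConjectureCMTwoRankZeroOfPubOfFlat` — modus ponens. [cite: Kato2004Asterisque, Thm. 12.5 (p. 222), Prop. 15.9]
[cite: PollackRubin2004, Thm. 7.3 (p > 2)] -/
theorem signedMainConjectureCMTwoRankZeroOfPubOfFlatGlue_proof :
    Summit.BirchSwinnertonDyer.BirchSwinnertonDyer.Theses.ThetaPartnerAtTwo.SignedMainConjectureCMTwoRankZeroOfPubOfFlatGlue := by
  unfold Summit.BirchSwinnertonDyer.BirchSwinnertonDyer.Theses.ThetaPartnerAtTwo.SignedMainConjectureCMTwoRankZeroOfPubOfFlatGlue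
    Summit.BirchSwinnertonDyer.BirchSwinnertonDyer.Theses.ThetaPartnerAtTwo.SignedMainConjectureCMTwoRankZeroOfPubOfFlatOfKZ
  intro h1 h2
  exact h2 h1

end Summit.BirchSwinnertonDyer.BirchSwinnertonDyer.Theorems
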